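import Mathlib
import HarnessLib
import HarnessLib.Audit
import Summits.AtomisticToContinuum.Statement
import Literature.MathematicalPhysics.QuantumManyBody.PeriodicBoseGas
import Summits.AtomisticToContinuum.BoseEinsteinCondensation.Theorems.BECGroundStateSOSPeriodicEnergyFinite

/-!
Route: BECGhostPlasma

CLOSED (retired) 2026-08-15T13:38:44Z by operator:999:1257524 — reason: not-a-thesis: assembly does not conclude the sub-problem Statement — note: D-0027 §2.1 audit (human 2026-08-15: routes that do not decide the summit are removed): the assembly concludes `Literature.MathematicalPhysics.QuantumManyBody.BoseGas.BoseEinsteinCondensation`, not the sub-problem statement; a NEW conforming route may be opened from the same idea (generated `closes . The file is kept as the record of this route; refuted decls are indexed as negative knowledge (`ledger negatives`).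

# Route BECGhostPlasma — Ghost plasma — torus ODLRO as screening of two half-charges in the
classical shadow e^{-2S} of the positive ground state, S a Riccati cluster fixed point

Realises idea card riccati-cluster-ghost-plasma (which absorbed classical-shadow-hjb-cluster and
laughlin-plasma-analogy-debye-equals-healing). It suffices to show X = GhostPairScreening on the
TORUS: for every repulsive finite-range v, at all small densities ρ, there is c > 0 such that for
all large N and EVERY δ > 0 some δ-near-minimiser Ψ of the periodic N-body energy (side L =
(N/ρ)^(1/3)) that is pointwise ≥ 0 and translation invariant has one-particle density matrix
γ_Ψ(x,y) = N ∫ Ψ(x,Y) Ψ(y,Y) dY ≥ c·ρ for ALL x, y. In the classical shadow μ = Ψ² dX = e^(−2S) dX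
this reads: the excess free energy of splitting a unit test charge at x into two half-charges at x
and y is ≤ log(1/c) uniformly in |x−y| and L — fractional charges are SCREENED (γ/ρ =
Z[half,half]/Z[unit], the McMillan/Girvin–MacDonald identity). Glue: PeriodicPhaseRigidity (every
δ-near-minimiser is L²-close to e^(iθ)Ψ once δ = δ(N) is small) turns the pointwise floor into
constant-mode occupation ≥ (c/4)N for all near-minimisers, i.e. PeriodicBEC (Target, shared with
route BECPeriodicReduction), and that route's BoundaryTransferWeak (shared crux) carries it to the
Dirichlet conjunct. The ENGINE behind X is the card's pair of informal cruxes (filed after open,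
ranks 3–4): the Riccati cluster fixed point for S = −log Ψ₀ and a Debye-type screening theorem for
the resulting kernel class.
Lean: `∀ v : ℝ → ENNReal,
Literature.MathematicalPhysics.QuantumManyBody.BoseGas.IsRepulsiveFiniteRange v → ∃ ρ₀ : ℝ, 0 < ρ₀ ∧
∀ ρ : ℝ, 0 < ρ → ρ < ρ₀ → ∃ c : ℝ, 0 < c ∧ ∀ᶠ n : ℕ in Filter.atTop, ∀ δ : ENNReal, 0 < δ → ∃ Ψ :
Literature.MathematicalPhysics.QuantumManyBody.BoseGas.PeriodicTrialState (n + 1)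
(Literature.MathematicalPhysics.QuantumManyBody.BoseGas.sideLength ρ (n + 1)),
Literature.MathematicalPhysics.QuantumManyBody.BoseGas.periodicEnergy v Ψ ≤
Literature.MathematicalPhysics.QuantumManyBody.BoseGas.periodicGroundStateEnergy v (n + 1)
(Literature.MathematicalPhysics.QuantumManyBody.BoseGas.sideLength ρ (n + 1)) + δ ∧ (∀ X, Ψ.ψ X =
(‖Ψ.ψ X‖ : ℂ)) ∧ (∀ (a : EuclideanSpace ℝ (Fin 3)) (X : Fin (n + 1) → EuclideanSpace ℝ (Fin 3)), Ψ.ψ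
(fun i => X i + a) = Ψ.ψ X) ∧ ∀ x y : EuclideanSpace ℝ (Fin 3), ENNReal.ofReal (c * ρ) ≤ (((n :
ENNReal) + 1) * ∫⁻ Y in Literature.MathematicalPhysics.QuantumManyBody.BoseGas.cellN n
(Literature.MathematicalPhysics.QuantumManyBody.BoseGas.sideLength ρ (n + 1)), (‖Ψ.ψ (Matrix.vecCons
x Y)‖₊ : ENNReal) * (‖Ψ.ψ (Matrix.vecCons y Y)‖₊ : ENNReal))`

## Assembly
GhostPairScreening gives, for each v and small ρ, positive translation-invariant representatives
with γ ≥ cρ at every δ; AveragingGlue (Tonelli + L²-Lipschitz continuity of √occupation +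
PeriodicPhaseRigidity, with PeriodicGroundStateEnergyFinite feeding rigidity's finiteness
hypothesis) yields the PeriodicBEC body for v; BoundaryTransferWeak v turns it into ∃ρ₀ ∀ρ∈(0,ρ₀)
HasGroundStateBEC v ρ, which is BoseEinsteinCondensation. Pure logic once AveragingGlue (and, if one
starts from GhostWorkBound, JensenGlue) are proved; all hypotheses inlined (the term is literally
GhostPairScreening → PeriodicPhaseRigidity → PeriodicGroundStateEnergyFinite → BoundaryTransferWeak
→ conjunct, checked by rfl in Sketch.lean).

Rationale: WHY THIS LINE. Mechanism (card riccati-cluster-ghost-plasma): write the positive torus ground state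
as Ψ₀ = e^(−S); HΨ₀ = E₀Ψ₀ is the many-body Riccati equation |∇S|² − ΔS = V − E₀, to be solved as a
fixed point S = Σ_{i<j} u₂ + Σ_{i<j<k} u₃ + … in a polymer-weighted Banach space (weight
(√(ρa³))^(k−2) on k-body kernels) whose pair linearisation is the zero-energy scattering equation
and whose collective linearisation is Bogoliubov's equation in first quantisation, renormalising the
pair tail from a/r to the Reatto–Chester b/r², û₂(k) ≍ 1/|k| (ReattoChester1967, Reatto1969; lattice
precedent WITH a gap: KirkwoodThomas1983, DattaKennedy2002). The Born law e^(−2S) is then a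
classical Gibbs field with S(k) ≍ |k| (hyperuniform), hence not a tempered short-range Gibbs state
(GhoshLebowitz2017 §2) but a weakly coupled plasma of 1/r²-charges with (√(ρa³))^(−1) ≫ 1 particles
per screening volume ξ³ (ξ = (8πρa)^(−1/2) = healing length = screening length), and γ(x,y)/ρ =
Z[two half-charges at x,y]/Z[one unit charge] exactly (McMillan estimator Mcmillan1965; slogan in
print for the Laughlin plasma: GirvinMacdonald1987), so ODLRO = bounded fractional-charge excess
free energy = screening — the regime of the Debye-screening expansions (BrydgesFederbush1980;
Imbrie1983 for jellium; half-space version FederbushKennedy1985), to be adapted to the û ≍ 1/|k|,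
many-body-kernel class where screening clouds are algebraic (r⁻⁴), as for loop plasmas
(BrydgesMartin1999, BalleneggerMartinAlastuey2002). Imported areas: constructive classical
statistical mechanics (polymer fixed points, Kac–Siegert/sine-Gordon representation of the
positive-definite tail — û = 1/|k| is the hyperplane trace of the 4-D massless field, so the
sine-Gordon action is local one dimension up — and Debye resummation) plus the physics of
Jastrow/CBF states; every object is positive and static, so the complex-Gaussian large-field problem
of Benfatto1994/BFKT (route BECRenormGroup; barrier BogoliubovPerturbationInfrared) does not arise
in that form. Versus existing routes and the negatives index (empty, 2026-08-15): BECInfraredBound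
and BECPinning are energy/infrared-bound lines, BECRenormGroup is the complex RG,
BECPeriodicReduction is the reformulation this route plugs into (Target = its PeriodicBEC, last crux
= its BoundaryTransferWeak); the torus is chosen because in a Dirichlet box the bare 1/r² landscape
varies by O(L/ξ) across the bulk and the neutralising one-body kernel would have to live inside crux
F.

RANKED CRUXES. #0 PeriodicBEC (target) — Torus BEC for near-minimisers (verbatim
stmt-AtomisticToContinuum-0826 of route BECPeriodicReduction, shared by signature): for every
repulsive finite-range v, small ρ, some c > 0, all large N, some δ > 0, every periodic
δ-near-minimiser has constant-mode occupation ≥ cN. [difficulty: open-problem] (why it might fail: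
It is the open problem in the literature's own setting; every printed bound pays the inverse kinetic
gap L² (Fournais2020 Thm 1.2, Junge2026 Cor. 6).) [LiebSeiringerSolovejYngvason2005, Fournais2020,
arXiv:2603.20776]
#2 GhostPairScreening (crux) — [card crux S output, typed; the thesis X] ∀ v repulsive finite-range
∃ρ₀ ∀ρ∈(0,ρ₀) ∃c>0 ∀ᶠ n ∀δ>0 ∃ Ψ ∈ PeriodicTrialState (n+1) L (L = sideLength ρ (n+1)) with
periodicEnergy ≤ E₀^per + δ, Ψ ≥ 0 pointwise (Ψ.ψ X = ‖Ψ.ψ X‖), translation invariant, and for ALL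
x, y: (n+1)·∫_{cellN n} Ψ(x::Y) Ψ(y::Y) dY ≥ c·ρ — the two-half-ghost excess free energy
−log(γ(x,y)/ρ) is ≤ log(1/c) uniformly in separation and volume (fractional test charges are
screened in the classical shadow). v ≡ 0: true with Ψ = constant, c = 1. Ranks 3–4 are the informal
engine cruxes RiccatiClusterFixedPoint and KernelClassScreening (filed after open). [difficulty:
open-problem] (why it might fail: Needs r^(-3-ε) screening clouds (pair correlation of |Ψ₀|² ~ r⁻⁴)
and L-uniform k≥3 kernels: if fractional charges are only marginally screened the ghost free energy
grows like log L and only quasi-ODLRO N^(1-η) survives; hard cores need C¹ translation-invariant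
cut-off representatives.) [Reatto1969, GirvinMacdonald1987, Mcmillan1965, Chester1970,
PenroseOnsager1956, LiebSeiringerSolovejYngvason2005]
#5 PeriodicPhaseRigidity (crux) — L² phase rigidity of torus near-minimisers at fixed N (the
needle-proofing of every pointwise statement): ∀ v ∃ρ₀ ∀ρ∈(0,ρ₀) ∀ᶠ N, E₀^per(N,L) ≠ ⊤ → ∀η>0 ∃δ>0 ∀
Ψ Φ periodic δ-near-minimisers ∃θ: ∫_{cellN} |Ψ − e^(iθ)Φ|² ≤ η. Content: uniqueness of the periodic
ground state up to phase (Perron–Frobenius / positivity-improving semigroup; hard cores: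
connectedness of the hard-sphere configuration space on the torus) + compact resolvent (gap at fixed
N, L; δ ≤ η·gap). v ≡ 0: true (gap (2π/L)²). [difficulty: M] (why it might fail: Hard cores: needs
the torus hard-sphere configuration space {|x_i−x_j|_T > a} connected for ALL large N at fixed small
ρa³ — printed connectivity results fix N and shrink the radius (Diaconis–Lebeau–Michel); a
positive-measure caged component for infinitely many N makes it false.)
[doi:10.1007/s00222-010-0303-6, doi:10.1093/imrn/rnt012, LiebSeiringerSolovejYngvason2005,
PenroseOnsager1956]
#6 BoundaryTransferWeak (crux) — Boundary-condition transfer (verbatim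
stmt-AtomisticToContinuum-0827 of route BECPeriodicReduction, shared by signature): for each
repulsive finite-range v, PeriodicBEC(v) implies ∃ρ₀>0 ∀ρ∈(0,ρ₀) HasGroundStateBEC v ρ (Dirichlet,
mode-free). [difficulty: L] (why it might fail: PeriodicBEC(v) is ground-state-only (δ after N): the
Dirichlet ground state lies a wall term ≫ δ above E₀^per and interior restrictions are neither
periodic nor of sharp N, so the hypothesis may never fire; only the ENERGY transfer is in print.)
[LiebSeiringerSolovejYngvason2005, arXiv:2203.01841, arXiv:2205.15284, doi:10.1007/bf01608554]
#9 GhostWorkBound (support) — [support, stronger first-moment form of the thesis — what a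
free-ENERGY expansion delivers] same representatives as GhostPairScreening with, for all x, y: (a)
P_x(no core overlap at y) ≥ 1/2, i.e. (n+1)∫_{Ψ(y::Y)≠0} Ψ(x::Y)² dY ≥ ρ/2; (b) mean ghost work
bounded: (n+1)∫_{Ψ(y::Y)≠0} Ψ(x::Y)² · max(0, log Ψ(x::Y) − log Ψ(y::Y)) dY ≤ C·ρ (E_{P_x}[(S(y,·) −
S(x,·))⁺ ; no overlap] ≤ C: moving the test charge between two bulk points costs bounded mean work =
perfect screening of the interior). Implies GhostPairScreening with c = e^(−2C)/2 by conditioned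
Jensen (item JensenGlue). v ≡ 0: true (work ≡ 0). [difficulty: open-problem] [Reatto1969,
BrydgesFederbush1980, Imbrie1983]
#9 JensenGlue (support) — GhostWorkBound → GhostPairScreening: on G = {Ψ(y::·) ≠ 0}, Ψ(y::Y) =
Ψ(x::Y) e^(−Δ), Δ = log Ψ(x::Y) − log Ψ(y::Y) ≤ Δ⁺; weighted Jensen for exp on the probability
weight Ψ(x::·)² 1_G / m gives γ(x,y) ≥ m·exp(−W/m) ≥ (ρ/2) e^(−2C) with m ≥ ρ/2 (a) and W ≤ Cρ (b).
Pure measure theory (lintegral ↔ Bochner, Jensen `ConvexOn.map_average_le`). [difficulty: M]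
[folklore, Mathlib: ConvexOn.map_average_le]
#9 AveragingGlue (support) — GhostPairScreening → PeriodicPhaseRigidity →
PeriodicGroundStateEnergyFinite → PeriodicBEC: (1) for real Ψ ≥ 0, condensateOccupation (n+1) L Ψ =
L⁻³ ∫∫_{cell²} γ_Ψ(x,y) dx dy (Tonelli with Matrix.vecCons) ≥ L⁻³·L⁶·cρ = c(n+1); (2)
√(occupation/(n+1)) is 1-Lipschitz in L²(cellN) (it is ‖AΨ‖ for a contraction A) and phase
invariant, so with η = c/4 and δ from rigidity every δ-near-minimiser Φ has occupation ≥ (c/4)(n+1);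
(3) ρ₀ := min of the three thresholds, ∀ᶠ from the three eventualities. [difficulty: L]
[LiebSeiringerSolovejYngvason2005, Fournais2020]
#9 PeriodicGroundStateEnergyFinite (support) — E₀^per(N, (N/ρ)^(1/3)) < ⊤ for ρ < ρ₀(v) and all
large N (periodic twin of stmt-AtomisticToContinuum-0850): N symmetrised C¹ bumps on a lattice of
spacing > range R₀ (hard cores included since ⊤·0 = 0), using interaction-free configurations;
hypothesis of PeriodicPhaseRigidity and of the assembly (ENNReal bookkeeping). [difficulty:
provable-now] [LiebSeiringerSolovejYngvason2005]
#9 ShadowHyperuniformity (support) — [support, dictionary row 1: 'S(k) ≍ |k| ⇔ the shadow is a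
plasma'] for v with scattering length a > 0: ∃ρ₀ ∀ρ∈(0,ρ₀) ∃C ∀ᶠ n ∀δ>0 ∃ representative Ψ (as in
GhostPairScreening) whose structure factor obeys N·S(k) = ∫_{cellN} |Σ_j e^(ip·x_j)|² Ψ² dX ≤
C·|p|·(n+1) for all p = 2πk/L, k ∈ ℤ³∖0 (Bogoliubov: S(p) = p/√(p²+16πρa); false for v ≡ 0 where S ≡
1, hence a > 0). The Onsager/f-sum side S(k) ≤ k√(χ(k))/2 makes it a bound on the static density
response; in the dictionary it is the perfect-screening (Stillinger–Lovett-type) input that forces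
the non-integrable 1/r² pair kernel (Ghosh–Lebowitz: hyperuniform ⇒ not tempered Gibbs).
[difficulty: open-problem] [ReattoChester1967, GhoshLebowitz2017, LiebSeiringerSolovejYngvason2005,
doi:10.1007/bf01015731]

TWO-LAYER PLAN. Foreseen once a crux closes (nothing filed now): GhostPairScreening ⇐
RiccatiClusterFixedPoint → KernelClassScreening → GhostPairScreening (glue = 'the fixed point lies
in the screened class', needs notion ManyBodyKernelExpansion); KernelClassScreening ⇐
PairClassScreening (Jastrow/Reatto–Chester pair kernel only: the Riesz-2 jellium with hard core
screens half-charges) → ManyBodyPerturbationStability (k ≥ 3 kernels of weight (√(ρa³))^(k−2) change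
the ghost free energy by ≤ C√(ρa³): card crux P) → KernelClassScreening; PeriodicPhaseRigidity ⇐
SoftPotentialRigidity → HardSphereConnectivity → PeriodicPhaseRigidity.

KILL CRITERIA. ¬GhostPairScreening for some admissible v at arbitrarily small ρ (no ODLRO in the
torus ground state) closes the route (close --reason refuted:GhostPairScreening) and, physically,
the conjunct. ¬PeriodicPhaseRigidity via a disconnected hard-sphere configuration space for
infinitely many N forces a pivot (restate for potentials with ∫v < ∞ plus a hard-core limit crux),
not closure. ¬BoundaryTransferWeak breaks this assembly together with BECPeriodicReduction's: pivot
to the Dirichlet inner-box form of GhostPairScreening with the wall kernel u₁ inside crux F (surface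
screening à la FederbushKennedy1985). A proof that ‖u₃‖ must grow like log L (crux F) or that the
e^(−2S) class cannot screen fractional charges (crux S) retires the ENGINE: the typed spine is then
only a reformulation and the route is closed superseded-by whichever positivity route
(palm-hellinger / riesz-shadow engines) is alive. ¬ShadowHyperuniformity ⇒ the plasma dictionary is
wrong ⇒ close.

NOT DECOMPOSED YET. The Banach space and norms of the fixed point (definition request below); the
Kac–Siegert split of u₂ into core + positive-definite tail and the sine-Gordon-on-a-brane
representation; hard cores inside the expansion; the C¹ cut-off construction of representatives from
the true ground state; JensenGlue/AveragingGlue measure-theoretic lemmas (Tonelli with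
Matrix.vecCons, L²-Lipschitz of √occupation) are supports, not split further; the Dirichlet-direct
variant (inner box, one-body wall kernel); T > 0. Constants: c(ρ) is expected ≥ 1 − C√(ρa³) but only
c > 0 is asked (c may be e^(−100)).

CHEAPEST FALSIFIER. (i) Classical Monte Carlo of the PAIR class alone: sample μ ∝ Π f₀(r_ij)²
e^(−2b/r_ij² · cutoff) on tori L/ξ ∈ {4, 8, 16, 32} at ρa³ ∈ {10⁻⁴, 10⁻³} and measure the McMillan
ghost ratio ⟨Ψ(y,Y)/Ψ(x,Y)⟩_{P_x} at |x−y| = L/2: saturation in L is required by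
KernelClassScreening already for u₃ ≡ 0; a log L drift retires crux S (kit compute, a few
node-hours; not run: hub compute-free, one-shot unit). (ii) Lookup: whether Peilen–Serfaty
arXiv:2511.18623 (local laws/fluctuations for Riesz d−2 < s < d, here s = 2, d = 3) already yields
volume-uniform exponential moments of the half-charge potential difference — then the pair-class
half of crux S is 'known' and the open content shrinks to crux F + many-body stability. (iii) Hand
sanity (done): every typed item is true for v ≡ 0 with Ψ = constant (c = 1, work ≡ 0, gap (2π/L)²);
ShadowHyperuniformity correctly EXCLUDES v ≡ 0 (S ≡ 1) by its hypothesis a > 0.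

NUMBERS. Units ħ = 2m = 1. Bogoliubov: E_p = √(p⁴ + 16πρa p²), c_s = 4√(πρa), S(p) = p²/E_p →
p/(4√(πρa)); healing = screening length ξ = (8πρa)^(−1/2); Reatto–Chester tail u₂(r) → b/r², û₂(p) =
2π²b/|p| = c_s/(ρ|p|), b = 2π^(−3/2) a^(1/2) ρ^(−1/2); coupling at mean spacing bρ^(2/3) =
2π^(−3/2)(ρa³)^(1/6); particles per screening volume ρξ³ = (8π)^(−3/2)(ρa³)^(−1/2); screened
ghost–ghost interaction ~ 2b/(κ²r⁴), κ = 4π²bρ ~ ξ⁻¹; expected condensate fraction n₀/ρ = 1 −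
(8/(3√π))√(ρa³) (LiebSeiringerSolovejYngvason2005 App. A), so c ≈ 1 in GhostPairScreening at small
ρa³; d = 1 dictionary check: log-gas, γ ~ |x−y|^(−1/2) (LiebLiniger1963/Girardeau1960, barrier
OneDimensionalHardCore).

DEFINITION REQUESTS. notion ManyBodyKernelExpansion (topic
Summits/AtomisticToContinuum/BoseEinsteinCondensation/Theorems; for cruxes
RiccatiClusterFixedPoint/KernelClassScreening): for a positive, symmetric, translation-invariant Ψ
on the 3N-torus, the representation −log Ψ(X) = Σ_{k≥2} Σ_{A⊆[N], |A|=k} u_k(X_A) with symmetric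
translation-invariant kernels, the pair kernel split u₂ = −log f₀ (zero-energy scattering solution,
PeriodicBoseGasScatteringSolution) + tail t with Fourier-symbol class |t̂(p)| ≤ C/|p|, and the
polymer norm ‖u‖_w := Σ_{k≥3} w^(−(k−2)) sup_{x₁} ∫ |u_k(x₁, x₂, …, x_k)| dx₂ ⋯ dx_k (w = √(ρa³)).
Literature facts wanted later as hypotheses for the engine (not for the typed spine, which is
fact-free): BrydgesFederbush1980 (Debye screening theorem), Imbrie1983 (jellium),
FederbushKennedy1985 (half-space).

Novelty: Searches (2026-08-15, this planner, on top of the card's own log and refuter audits AUDIT-1/AUDIT-14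
whose prior lists are adopted): lit frontier AtomisticToContinuum --since 2020 (30 rows; Bose
descendants arXiv:2603.20776, arXiv:2510.20493, arXiv:2602.16566, arXiv:2605.06844 —
energy/localisation lines, none positivity/classical-shadow); lit bridges --cross any (30 rows, no
Bose-specific bridge beyond arXiv:2002.02678); lit search --source crossref ×16 (Girvin–MacDonald
ODLRO plasma 8 hits; Kirkwood–Thomas 5; Datta–Kennedy 5; Brydges–Federbush 5;
Ballenegger–Martin–Alastuey 5; Brydges–Martin review 5; Carlen–Jauslin–Lieb 5; Chester 1970 5;
Reatto Jastrow impurity 5; Imbrie jellium 5; Federbush–Kennedy surface 5; Fontaine–Martin sum rules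
5; Serfaty Riesz fluctuations 5; Leblé–Serfaty 5; Diaconis–Lebeau–Michel 3;
Baryshnikov–Bubenik–Kahle 3); lit galaxy search --star all ×4 ("logarithm of the ground state wave
function cluster expansion Bose", "half charge impurity free energy plasma off-diagonal", "McMillan
condensate fraction ghost particle Jastrow Monte Carlo", "Jastrow wave function Bose-Einstein
condensation": 3 empty, 1 timeout rc 124) and --star pdf "Debye screening" (5 noise hits); local
searchd down (connection reset), arXiv API 429.
Nearest prior art found: GirvinMacdonald1987 (doi:10.1103/physrevlett.58.1252) — off-diagonal
density matrix of the Laughlin state = partition-function ratio with two half-charge impurities in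
the plasma, screening decides order (the sl  [refs: 10.1103/physrevlett.58.1252, 10.1214/20-aop1445, 2603.20776, 2510.20493, 2602.16566, 2605.06844, 2002.02678, 2511.18623, doi:10.1103/physrevlett.58.1252, doi:10.1214/20-aop1445, GirvinMacdonald1987, Reatto1969, Chester1970, Mcmillan1965, PenroseOnsager1956, KirkwoodThomas1983, DattaKennedy2002, BrydgesFederbush1980, Imbrie1983, FederbushKennedy1985, BrydgesMartin1999, BalleneggerMartinAlastuey2002]

Barriers (technique_class: riccati-fixed-point, classical-screening, positivity): - technique_class: riccati-fixed-point, classical-screening, positivity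
- Literature.Barriers.AtomisticToContinuum.BogoliubovPerturbationInfrared: applies to crux
RiccatiClusterFixedPoint only and partially — the iteration expands around Bogoliubov, but in STATIC
configuration-space kernels of a positive function whose infrared inputs (S(k), u₂) are
gauge-invariant equal-time quantities, listed by BogoliubovPerturbationInfraredNarrow as
non-divergent; the catalogued object ∫G_c² (frequency-dependent bubble, d ≤ 3) never appears. Honest
bet: ‖u₃‖ is L-uniform in d = 3; kill signal = log L growth (crux F why-might-fail). The typed spine
(GhostPairScreening, rigidity, transfer) uses no expansion.
- Literature.Barriers.AtomisticToContinuum.KineticGapLengthScalesNarrow: outside its class by its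
own list — the line uses the true ground state beyond the VALUE of its energy (positivity Ψ₀ > 0,
the eigenvalue equation pointwise as the Riccati equation, and the repulsion through the scattering
core), which the entry names as NOT an energy-window argument (scope_caveat (b′): 'whether
positivity is an exit is open' — this route is a bet on exactly that exit, made d = 3-specific by
the screening integral so the d = 1 positive counterexamples are respected); the only energy window
used is δ = δ(N) below the fixed-(N,L) spectral gap inside PeriodicPhaseRigidity, i.e. M = 0 in
conjunct (3) (`energyWindow_fraction_le` gives c ≤ 1, no constraint), and the Galilei-boost witness
of conjunct (2)

History (route lifecycle, newest last):
- 2026-08-15T13:38:44Z · CLOSED retired — not-a-thesis: assembly does not conclude the sub-problem Statement (operator:999:1257524)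

sub-problem: BoseEinsteinCondensation · status: closed(retired) · opened planner-plancard-AtomisticToContinuum-BoseEin-abfb0aaf-0 2026-08-15T11:29:25Z · rev 0 · ledger route-AtomisticToContinuum-BECGhostPlasma
GENERATED by the gate from the ledger (D-0016/17). Provers cite these decls: `theorem foo : Summit.AtomisticToContinuum.BoseEinsteinCondensation.Theses.BECGhostPlasma.<Decl> := …` in Summits/AtomisticToContinuum/BoseEinsteinCondensation/Theorems/<Name>.lean.
-/

namespace Summit.AtomisticToContinuum.BoseEinsteinCondensation.Theses.BECGhostPlasma

open scoped BigOperators Topology Manifold Classical MeasureTheory ProbabilityTheory Matrix InnerProductSpace ComplexConjugate ContinuousMap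
open Filter Set Function TopologicalSpace MeasureTheory

attribute [summit_statement] _root_.BoseEinsteinCondensation

/-- item stmt-AtomisticToContinuum-0826 · target · rank 0 · closed · moot by None · by planner
why it might fail: It is the open problem in the literature's own setting; every printed bound pays the inverse kinetic gap L² (Fournais2020 Thm 1.2, Junge2026 Cor. 6).
sources: LiebSeiringerSolovejYngvason2005, Fournais2020, arXiv:2603.20776
[crux] PeriodicBEC: for every repulsive finite-range radial v there is ρ₀>0 such that for 0<ρ<ρ₀
there is c>0 with: for all large N there is δ>0 such that every PERIODIC trial state Ψ on the torus
of side L=(N/ρ)^{1/3} with periodicEnergy ≤ E₀^per(N,L)+δ has constant-mode occupation ⟨Ψ,n₀Ψ⟩ =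
condensateOccupation N L Ψ ≥ cN. The open problem in the literature's own (translation-invariant)
setting; Fournais2020 Thm 1.2 gives it on scales L ≤ C(ρa³)^{-δ}(ρa)^{-1/2}, Junge2026 Cor. 6
(Neumann) up to a(ρa³)^{-3/4-η}. Sources: LiebSeiringerSolovejYngvason2005 Ch. 5; Fournais2020;
Junge2026; ChongLiangNam2026. -/
@[route_item "route-AtomisticToContinuum-BECGhostPlasma"]
def PeriodicBEC : Prop :=
  ∀ v : ℝ → ENNReal, Literature.MathematicalPhysics.QuantumManyBody.BoseGas.IsRepulsiveFiniteRange v → ∃ ρ₀ : ℝ, 0 < ρ₀ ∧ ∀ ρ : ℝ, 0 < ρ → ρ < ρ₀ → ∃ c : ℝ, 0 < c ∧ ∀ᶠ N : ℕ in Filter.atTop, ∃ δ : ENNReal, 0 < δ ∧ ∀ Ψ : Literature.MathematicalPhysics.QuantumManyBody.BoseGas.PeriodicTrialState N (Literature.MathematicalPhysics.QuantumManyBody.BoseGas.sideLength ρ N), Literature.MathematicalPhysics.QuantumManyBody.BoseGas.periodicEnergy v Ψ ≤ Literature.MathematicalPhysics.QuantumManyBody.BoseGas.periodicGroundStateEnergy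 v N (Literature.MathematicalPhysics.QuantumManyBody.BoseGas.sideLength ρ N) + δ → ENNReal.ofReal (c * N) ≤ Literature.MathematicalPhysics.QuantumManyBody.BoseGas.condensateOccupation N (Literature.MathematicalPhysics.QuantumManyBody.BoseGas.sideLength ρ N) Ψ.ψ

/-- item stmt-AtomisticToContinuum-4204 · crux · rank 2 · closed · moot by None · by planner
why it might fail: Needs r^(-3-ε) screening clouds (pair correlation of |Ψ₀|² ~ r⁻⁴) and L-uniform k≥3 kernels: if fractional charges are only marginally screened the ghost free energy grows like log L and only quasi-ODLRO N^(1-η) survives; hard cores need C¹ translation-invariant cut-off representatives.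
sources: Reatto1969, GirvinMacdonald1987, Mcmillan1965, Chester1970, PenroseOnsager1956, LiebSeiringerSolovejYngvason2005
[crux] [card crux S output, typed; the thesis X] ∀ v repulsive finite-range ∃ρ₀ ∀ρ∈(0,ρ₀) ∃c>0 ∀ᶠ n
∀δ>0 ∃ Ψ ∈ PeriodicTrialState (n+1) L (L = sideLength ρ (n+1)) with periodicEnergy ≤ E₀^per + δ, Ψ ≥
0 pointwise (Ψ.ψ X = ‖Ψ.ψ X‖), translation invariant, and for ALL x, y: (n+1)·∫_{cellN n} Ψ(x::Y)
Ψ(y::Y) dY ≥ c·ρ — the two-half-ghost excess free energy −log(γ(x,y)/ρ) is ≤ log(1/c) uniformly in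
separation and volume (fractional test charges are screened in the classical shadow). v ≡ 0: true
with Ψ = constant, c = 1. Ranks 3–4 are the informal engine cruxes RiccatiClusterFixedPoint and
KernelClassScreening (filed after open). [difficulty: open-problem] -/
@[route_item "route-AtomisticToContinuum-BECGhostPlasma"]
def GhostPairScreening : Prop :=
  ∀ v : ℝ → ENNReal, Literature.MathematicalPhysics.QuantumManyBody.BoseGas.IsRepulsiveFiniteRange v → ∃ ρ₀ : ℝ, 0 < ρ₀ ∧ ∀ ρ : ℝ, 0 < ρ → ρ < ρ₀ → ∃ c : ℝ, 0 < c ∧ ∀ᶠ n : ℕ in Filter.atTop, ∀ δ : ENNReal, 0 < δ → ∃ Ψ : Literature.MathematicalPhysics.QuantumManyBody.BoseGas.PeriodicTrialState (n + 1) (Literature.MathematicalPhysics.QuantumManyBody.BoseGas.sideLength ρ (n + 1)), Literature.MathematicalPhysics.QuantumManyBody.BoseGas.periodicEnergy v Ψ ≤ Literature.MathematicalPhysics.QuantumManyBody.BoseGas.periodicGroundStateEnergy v (n + 1) (Literature.MathematicalPhysics.QuantumManyBody.BoseGas.sideLength ρ (n + 1)) + δ ∧ (∀ X, Ψ.ψ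 X = (‖Ψ.ψ X‖ : ℂ)) ∧ (∀ (a : EuclideanSpace ℝ (Fin 3)) (X : Fin (n + 1) → EuclideanSpace ℝ (Fin 3)), Ψ.ψ (fun i => X i + a) = Ψ.ψ X) ∧ ∀ x y : EuclideanSpace ℝ (Fin 3), ENNReal.ofReal (c * ρ) ≤ (((n : ENNReal) + 1) * ∫⁻ Y in Literature.MathematicalPhysics.QuantumManyBody.BoseGas.cellN n (Literature.MathematicalPhysics.QuantumManyBody.BoseGas.sideLength ρ (n + 1)), (‖Ψ.ψ (Matrix.vecCons x Y)‖₊ : ENNReal) * (‖Ψ.ψ (Matrix.vecCons y Y)‖₊ : ENNReal))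

/-- item stmt-AtomisticToContinuum-4205 · crux · rank 5 · closed · moot by None · by planner
why it might fail: Hard cores: needs the torus hard-sphere configuration space {|x_i−x_j|_T > a} connected for ALL large N at fixed small ρa³ — printed connectivity results fix N and shrink the radius (Diaconis–Lebeau–Michel); a positive-measure caged component for infinitely many N makes it false.
sources: doi:10.1007/s00222-010-0303-6, doi:10.1093/imrn/rnt012, LiebSeiringerSolovejYngvason2005, PenroseOnsager1956
[crux] L² phase rigidity of torus near-minimisers at fixed N (the needle-proofing of every pointwise
statement): ∀ v ∃ρ₀ ∀ρ∈(0,ρ₀) ∀ᶠ N, E₀^per(N,L) ≠ ⊤ → ∀η>0 ∃δ>0 ∀ Ψ Φ periodic δ-near-minimisers ∃θ: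
∫_{cellN} |Ψ − e^(iθ)Φ|² ≤ η. Content: uniqueness of the periodic ground state up to phase
(Perron–Frobenius / positivity-improving semigroup; hard cores: connectedness of the hard-sphere
configuration space on the torus) + compact resolvent (gap at fixed N, L; δ ≤ η·gap). v ≡ 0: true
(gap (2π/L)²). [difficulty: M] -/
@[route_item "route-AtomisticToContinuum-BECGhostPlasma"]
def PeriodicPhaseRigidity : Prop :=
  ∀ v : ℝ → ENNReal, Literature.MathematicalPhysics.QuantumManyBody.BoseGas.IsRepulsiveFiniteRange v → ∃ ρ₀ : ℝ, 0 < ρ₀ ∧ ∀ ρ : ℝ, 0 < ρ → ρ < ρ₀ → ∀ᶠ N : ℕ in Filter.atTop, Literature.MathematicalPhysics.QuantumManyBody.BoseGas.periodicGroundStateEnergy v N (Literature.MathematicalPhysics.QuantumManyBody.BoseGas.sideLength ρ N) ≠ ⊤ → ∀ η : ℝ, 0 < η → ∃ δ : ENNReal, 0 < δ ∧ ∀ Ψ Φ : Literature.MathematicalPhysics.QuantumManyBody.BoseGas.PeriodicTrialState N (Literature.MathematicalPhysics.QuantumManyBody.BoseGas.sideLength ρ N), Literature.MathematicalPhysics.QuantumManyBody.BoseGas.periodicEnergy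 v Ψ ≤ Literature.MathematicalPhysics.QuantumManyBody.BoseGas.periodicGroundStateEnergy v N (Literature.MathematicalPhysics.QuantumManyBody.BoseGas.sideLength ρ N) + δ → Literature.MathematicalPhysics.QuantumManyBody.BoseGas.periodicEnergy v Φ ≤ Literature.MathematicalPhysics.QuantumManyBody.BoseGas.periodicGroundStateEnergy v N (Literature.MathematicalPhysics.QuantumManyBody.BoseGas.sideLength ρ N) + δ → ∃ θ : ℝ, (∫⁻ X in Literature.MathematicalPhysics.QuantumManyBody.BoseGas.cellN N (Literature.MathematicalPhysics.QuantumManyBody.BoseGas.sideLength ρ N), (‖Ψ.ψ X - Complex.exp (↑θ * Complex.I) * Φ.ψ X‖₊ : ENNReal) ^ 2) ≤ ENNReal.ofReal η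

/-- item stmt-AtomisticToContinuum-0827 · crux · rank 6 · open · by planner
why it might fail: PeriodicBEC(v) is ground-state-only (δ after N): the Dirichlet ground state lies a wall term ≫ δ above E₀^per and interior restrictions are neither periodic nor of sharp N, so the hypothesis may never fire; only the ENERGY transfer is in print.
sources: LiebSeiringerSolovejYngvason2005, arXiv:2203.01841, arXiv:2205.15284, doi:10.1007/bf01608554
[crux] BoundaryTransferWeak (mode-free boundary-condition transfer, per potential): for each
repulsive finite-range v, PeriodicBEC(v) implies ∃ρ₀>0 ∀ρ∈(0,ρ₀) HasGroundStateBEC v ρ (Dirichlet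
ground state, λ_max(γ) ≥ cN via condensateNumber). Not glue: near-minimiser slacks are O(N/L²) while
Dirichlet/periodic energies differ by a boundary term ≫ N/L², so no energy-comparison proof;
expected route: Neumann bracketing of interior sub-boxes (−Δ_Dir ≥ ⊕−Δ_Neu, v ≥ 0) + a mode-free
criterion (λ_max ≥ tr γ²/N). Only the ENERGY analogue is in print (LiebSeiringerSolovejYngvason2005
Ch. 2 after (2.8)). v ≡ 0: hypothesis and conclusion both true. -/
@[route_item "route-AtomisticToContinuum-BECGhostPlasma"]
def BoundaryTransferWeak : Prop :=
  ∀ v : ℝ → ENNReal, Literature.MathematicalPhysics.QuantumManyBody.BoseGas.IsRepulsiveFiniteRange v → (∃ ρ₀ : ℝ, 0 < ρ₀ ∧ ∀ ρ : ℝ, 0 < ρ → ρ < ρ₀ → ∃ c : ℝ, 0 < c ∧ ∀ᶠ N : ℕ in Filter.atTop, ∃ δ : ENNReal, 0 < δ ∧ ∀ Ψ : Literature.MathematicalPhysics.QuantumManyBody.BoseGas.PeriodicTrialState N (Literature.MathematicalPhysics.QuantumManyBody.BoseGas.sideLength ρ N), Literature.MathematicalPhysics.QuantumManyBody.BoseGas.periodicEnergy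 v Ψ ≤ Literature.MathematicalPhysics.QuantumManyBody.BoseGas.periodicGroundStateEnergy v N (Literature.MathematicalPhysics.QuantumManyBody.BoseGas.sideLength ρ N) + δ → ENNReal.ofReal (c * N) ≤ Literature.MathematicalPhysics.QuantumManyBody.BoseGas.condensateOccupation N (Literature.MathematicalPhysics.QuantumManyBody.BoseGas.sideLength ρ N) Ψ.ψ) → ∃ ρ₀ : ℝ, 0 < ρ₀ ∧ ∀ ρ : ℝ, 0 < ρ → ρ < ρ₀ → Literature.MathematicalPhysics.QuantumManyBody.BoseGas.HasGroundStateBEC v ρ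

-- item stmt-AtomisticToContinuum-5032 · support · rank 3 · closed · moot by None · by planner — informal only, no Lean statement yet:
--   [crux] RICCATI CLUSTER FIXED POINT (card crux F; informal until notion ManyBodyKernelExpansion
--   lands). For every repulsive finite-range v there are ρ₀ > 0 and C such that for 0 < ρ < ρ₀, all
--   large N and L = (N/ρ)^(1/3), the positive translation-invariant torus ground state is Ψ₀ = e^(−S)
--   with S = Σ_{i<j} u₂ + Σ_{i<j<k} u₃ + … (symmetric translation-invariant k-body kernels), where u₂ =
--   −log f₀ (zero-energy scattering solution, PeriodicBoseGasScatteringSolution) + t with Reatto–Chester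
--   tail t(r) → b/r², |t̂(p)| ≤ C/|p|, b = 2π^(−3/2) a^(1/2) ρ^(−1/2) (û₂(p) → c_s/(ρ|p|), c_s =
--   4√(πρa), ħ = 2m =

-- item stmt-AtomisticToContinuum-5075 · support · rank 4 · closed · moot by None · by planner — informal only, no Lean statement yet:
--   [crux] KERNEL-CLASS SCREENING OF FRACTIONAL CHARGES (card crux S; informal until notion
--   ManyBodyKernelExpansion lands; pure classical statistical mechanics). For classical point fields on
--   the 3-torus of side L with N = ρL³ particles and Gibbs weight μ ∝ e^(−2S) dX, S = Σ_{i<j} u₂ +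
--   Σ_{k≥3} u_k in the class of RiccatiClusterFixedPoint (u₂ = −log f₀ + t, repulsive scattering core of
--   length a, positive-definite tail with |t̂(p)| ≤ C₀/|p| and t(r) → b/r², polymer norm of the k ≥ 3
--   kernels ≤ C₀ with weight √(ρa³)), there are ρ₀, C depending only on (a, C₀, range) such that for ρa³
--   < ρ₀a³, uniformly

/-- item stmt-AtomisticToContinuum-3974 · support · rank 9 · closed · proved by Summit.AtomisticToContinuum.BoseEinsteinCondensation.Theorems.periodicEnergyFinite_proof (prover) · by planner
sources: LiebSeiringerSolovejYngvason2005
[support] FINITENESS: for repulsive finite-range v (range R₀) there is ρ₀ > 0 with E₀^per(N,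
(N/ρ)^{1/3}) < ⊤ for ρ < ρ₀ and all large N (N bumps at mutual torus distance > R₀; or directly from
LSSY2005_upperBound_periodic_holds once scatteringLength v ≠ ⊤, cf. stmt-AtomisticToContinuum-0851).
Needed to subtract in ℝ≥0∞ and to make the near-minimiser hypotheses non-vacuous. [difficulty:
provable-now] -/
@[route_item "route-AtomisticToContinuum-BECGhostPlasma"]
def PeriodicGroundStateEnergyFinite : Prop :=
  ∀ v : ℝ → ENNReal, Literature.MathematicalPhysics.QuantumManyBody.BoseGas.IsRepulsiveFiniteRange v → ∃ ρ₀ : ℝ, 0 < ρ₀ ∧ ∀ ρ : ℝ, 0 < ρ → ρ < ρ₀ → ∀ᶠ N : ℕ in Filter.atTop, Literature.MathematicalPhysics.QuantumManyBody.BoseGas.periodicGroundStateEnergy v N (Literature.MathematicalPhysics.QuantumManyBody.BoseGas.sideLength ρ N) ≠ ⊤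

/-- item stmt-AtomisticToContinuum-4206 · support · rank 9 · closed · moot by None · by planner
sources: Reatto1969, BrydgesFederbush1980, Imbrie1983
[support] [support, stronger first-moment form of the thesis — what a free-ENERGY expansion
delivers] same representatives as GhostPairScreening with, for all x, y: (a) P_x(no core overlap at
y) ≥ 1/2, i.e. (n+1)∫_{Ψ(y::Y)≠0} Ψ(x::Y)² dY ≥ ρ/2; (b) mean ghost work bounded: (n+1)∫_{Ψ(y::Y)≠0}
Ψ(x::Y)² · max(0, log Ψ(x::Y) − log Ψ(y::Y)) dY ≤ C·ρ (E_{P_x}[(S(y,·) − S(x,·))⁺ ; no overlap] ≤ C: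
moving the test charge between two bulk points costs bounded mean work = perfect screening of the
interior). Implies GhostPairScreening with c = e^(−2C)/2 by conditioned Jensen (item JensenGlue). v
≡ 0: true (work ≡ 0). [difficulty: open-problem] -/
@[route_item "route-AtomisticToContinuum-BECGhostPlasma"]
def GhostWorkBound : Prop :=
  ∀ v : ℝ → ENNReal, Literature.MathematicalPhysics.QuantumManyBody.BoseGas.IsRepulsiveFiniteRange v → ∃ ρ₀ : ℝ, 0 < ρ₀ ∧ ∀ ρ : ℝ, 0 < ρ → ρ < ρ₀ → ∃ C : ℝ, 0 < C ∧ ∀ᶠ n : ℕ in Filter.atTop, ∀ δ : ENNReal, 0 < δ → ∃ Ψ : Literature.MathematicalPhysics.QuantumManyBody.BoseGas.PeriodicTrialState (n + 1) (Literature.MathematicalPhysics.QuantumManyBody.BoseGas.sideLength ρ (n + 1)), Literature.MathematicalPhysics.QuantumManyBody.BoseGas.periodicEnergy v Ψ ≤ Literature.MathematicalPhysics.QuantumManyBody.BoseGas.periodicGroundStateEnergy v (n + 1) (Literature.MathematicalPhysics.QuantumManyBody.BoseGas.sideLength ρ (n + 1)) + δ ∧ (∀ X, Ψ.ψ X = (‖Ψ.ψ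 X‖ : ℂ)) ∧ (∀ (a : EuclideanSpace ℝ (Fin 3)) (X : Fin (n + 1) → EuclideanSpace ℝ (Fin 3)), Ψ.ψ (fun i => X i + a) = Ψ.ψ X) ∧ ∀ x y : EuclideanSpace ℝ (Fin 3), ENNReal.ofReal (ρ / 2) ≤ (((n : ENNReal) + 1) * ∫⁻ Y in Literature.MathematicalPhysics.QuantumManyBody.BoseGas.cellN n (Literature.MathematicalPhysics.QuantumManyBody.BoseGas.sideLength ρ (n + 1)), {Y' : Fin n → EuclideanSpace ℝ (Fin 3) | Ψ.ψ (Matrix.vecCons y Y') ≠ 0}.indicator (fun Y' => (‖Ψ.ψ (Matrix.vecCons x Y')‖₊ : ENNReal) ^ 2) Y) ∧ (((n : ENNReal) + 1) * ∫⁻ Y in Literature.MathematicalPhysics.QuantumManyBody.BoseGas.cellN n (Literature.MathematicalPhysics.QuantumManyBody.BoseGas.sideLength ρ (n + 1)), {Y' : Fin n → EuclideanSpace ℝ (Fin 3) | Ψ.ψ (Matrix.vecCons y Y') ≠ 0}.indicator (fun Y' => (‖Ψ.ψ (Matrix.vecCons x Y')‖₊ : ENNReal) ^ 2 * ENNReal.ofReal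 (max 0 (Real.log ‖Ψ.ψ (Matrix.vecCons x Y')‖ - Real.log ‖Ψ.ψ (Matrix.vecCons y Y')‖))) Y) ≤ ENNReal.ofReal (C * ρ)

/-- item stmt-AtomisticToContinuum-4207 · support · rank 9 · closed · moot by None · by planner
sources: folklore, Mathlib: ConvexOn.map_average_le
[support] GhostWorkBound → GhostPairScreening: on G = {Ψ(y::·) ≠ 0}, Ψ(y::Y) = Ψ(x::Y) e^(−Δ), Δ =
log Ψ(x::Y) − log Ψ(y::Y) ≤ Δ⁺; weighted Jensen for exp on the probability weight Ψ(x::·)² 1_G / m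
gives γ(x,y) ≥ m·exp(−W/m) ≥ (ρ/2) e^(−2C) with m ≥ ρ/2 (a) and W ≤ Cρ (b). Pure measure theory
(lintegral ↔ Bochner, Jensen `ConvexOn.map_average_le`). [difficulty: M] -/
@[route_item "route-AtomisticToContinuum-BECGhostPlasma"]
def JensenGlue : Prop :=
  (∀ v : ℝ → ENNReal, Literature.MathematicalPhysics.QuantumManyBody.BoseGas.IsRepulsiveFiniteRange v → ∃ ρ₀ : ℝ, 0 < ρ₀ ∧ ∀ ρ : ℝ, 0 < ρ → ρ < ρ₀ → ∃ C : ℝ, 0 < C ∧ ∀ᶠ n : ℕ in Filter.atTop, ∀ δ : ENNReal, 0 < δ → ∃ Ψ : Literature.MathematicalPhysics.QuantumManyBody.BoseGas.PeriodicTrialState (n + 1) (Literature.MathematicalPhysics.QuantumManyBody.BoseGas.sideLength ρ (n + 1)), Literature.MathematicalPhysics.QuantumManyBody.BoseGas.periodicEnergy v Ψ ≤ Literature.MathematicalPhysics.QuantumManyBody.BoseGas.periodicGroundStateEnergy v (n + 1) (Literature.MathematicalPhysics.QuantumManyBody.BoseGas.sideLength ρ (n + 1)) + δ ∧ (∀ X,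 Ψ.ψ X = (‖Ψ.ψ X‖ : ℂ)) ∧ (∀ (a : EuclideanSpace ℝ (Fin 3)) (X : Fin (n + 1) → EuclideanSpace ℝ (Fin 3)), Ψ.ψ (fun i => X i + a) = Ψ.ψ X) ∧ ∀ x y : EuclideanSpace ℝ (Fin 3), ENNReal.ofReal (ρ / 2) ≤ (((n : ENNReal) + 1) * ∫⁻ Y in Literature.MathematicalPhysics.QuantumManyBody.BoseGas.cellN n (Literature.MathematicalPhysics.QuantumManyBody.BoseGas.sideLength ρ (n + 1)), {Y' : Fin n → EuclideanSpace ℝ (Fin 3) | Ψ.ψ (Matrix.vecCons y Y') ≠ 0}.indicator (fun Y' => (‖Ψ.ψ (Matrix.vecCons x Y')‖₊ : ENNReal) ^ 2) Y) ∧ (((n : ENNReal) + 1) * ∫⁻ Y in Literature.MathematicalPhysics.QuantumManyBody.BoseGas.cellN n (Literature.MathematicalPhysics.QuantumManyBody.BoseGas.sideLength ρ (n + 1)), {Y' : Fin n → EuclideanSpace ℝ (Fin 3) | Ψ.ψ (Matrix.vecCons y Y') ≠ 0}.indicator (fun Y' => (‖Ψ.ψ (Matrix.vecCons x Y')‖₊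 : ENNReal) ^ 2 * ENNReal.ofReal (max 0 (Real.log ‖Ψ.ψ (Matrix.vecCons x Y')‖ - Real.log ‖Ψ.ψ (Matrix.vecCons y Y')‖))) Y) ≤ ENNReal.ofReal (C * ρ)) → (∀ v : ℝ → ENNReal, Literature.MathematicalPhysics.QuantumManyBody.BoseGas.IsRepulsiveFiniteRange v → ∃ ρ₀ : ℝ, 0 < ρ₀ ∧ ∀ ρ : ℝ, 0 < ρ → ρ < ρ₀ → ∃ c : ℝ, 0 < c ∧ ∀ᶠ n : ℕ in Filter.atTop, ∀ δ : ENNReal, 0 < δ → ∃ Ψ : Literature.MathematicalPhysics.QuantumManyBody.BoseGas.PeriodicTrialState (n + 1) (Literature.MathematicalPhysics.QuantumManyBody.BoseGas.sideLength ρ (n + 1)), Literature.MathematicalPhysics.QuantumManyBody.BoseGas.periodicEnergy v Ψ ≤ Literature.MathematicalPhysics.QuantumManyBody.BoseGas.periodicGroundStateEnergy v (n + 1) (Literature.MathematicalPhysics.QuantumManyBody.BoseGas.sideLength ρ (n + 1)) + δ ∧ (∀ X, Ψ.ψ X = (‖Ψ.ψ X‖ : ℂ)) ∧ (∀ (a :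 EuclideanSpace ℝ (Fin 3)) (X : Fin (n + 1) → EuclideanSpace ℝ (Fin 3)), Ψ.ψ (fun i => X i + a) = Ψ.ψ X) ∧ ∀ x y : EuclideanSpace ℝ (Fin 3), ENNReal.ofReal (c * ρ) ≤ (((n : ENNReal) + 1) * ∫⁻ Y in Literature.MathematicalPhysics.QuantumManyBody.BoseGas.cellN n (Literature.MathematicalPhysics.QuantumManyBody.BoseGas.sideLength ρ (n + 1)), (‖Ψ.ψ (Matrix.vecCons x Y)‖₊ : ENNReal) * (‖Ψ.ψ (Matrix.vecCons y Y)‖₊ : ENNReal)))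

/-- item stmt-AtomisticToContinuum-4208 · support · rank 9 · closed · moot by None · by planner
sources: LiebSeiringerSolovejYngvason2005, Fournais2020
[support] GhostPairScreening → PeriodicPhaseRigidity → PeriodicGroundStateEnergyFinite →
PeriodicBEC: (1) for real Ψ ≥ 0, condensateOccupation (n+1) L Ψ = L⁻³ ∫∫_{cell²} γ_Ψ(x,y) dx dy
(Tonelli with Matrix.vecCons) ≥ L⁻³·L⁶·cρ = c(n+1); (2) √(occupation/(n+1)) is 1-Lipschitz in
L²(cellN) (it is ‖AΨ‖ for a contraction A) and phase invariant, so with η = c/4 and δ from rigidity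
every δ-near-minimiser Φ has occupation ≥ (c/4)(n+1); (3) ρ₀ := min of the three thresholds, ∀ᶠ from
the three eventualities. [difficulty: L] -/
@[route_item "route-AtomisticToContinuum-BECGhostPlasma"]
def AveragingGlue : Prop :=
  (∀ v : ℝ → ENNReal, Literature.MathematicalPhysics.QuantumManyBody.BoseGas.IsRepulsiveFiniteRange v → ∃ ρ₀ : ℝ, 0 < ρ₀ ∧ ∀ ρ : ℝ, 0 < ρ → ρ < ρ₀ → ∃ c : ℝ, 0 < c ∧ ∀ᶠ n : ℕ in Filter.atTop, ∀ δ : ENNReal, 0 < δ → ∃ Ψ : Literature.MathematicalPhysics.QuantumManyBody.BoseGas.PeriodicTrialState (n + 1) (Literature.MathematicalPhysics.QuantumManyBody.BoseGas.sideLength ρ (n + 1)), Literature.MathematicalPhysics.QuantumManyBody.BoseGas.periodicEnergy v Ψ ≤ Literature.MathematicalPhysics.QuantumManyBody.BoseGas.periodicGroundStateEnergy v (n + 1) (Literature.MathematicalPhysics.QuantumManyBody.BoseGas.sideLength ρ (n + 1)) + δ ∧ (∀ X, Ψ.ψ X = (‖Ψ.ψ X‖ : ℂ)) ∧ (∀ (a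 : EuclideanSpace ℝ (Fin 3)) (X : Fin (n + 1) → EuclideanSpace ℝ (Fin 3)), Ψ.ψ (fun i => X i + a) = Ψ.ψ X) ∧ ∀ x y : EuclideanSpace ℝ (Fin 3), ENNReal.ofReal (c * ρ) ≤ (((n : ENNReal) + 1) * ∫⁻ Y in Literature.MathematicalPhysics.QuantumManyBody.BoseGas.cellN n (Literature.MathematicalPhysics.QuantumManyBody.BoseGas.sideLength ρ (n + 1)), (‖Ψ.ψ (Matrix.vecCons x Y)‖₊ : ENNReal) * (‖Ψ.ψ (Matrix.vecCons y Y)‖₊ : ENNReal))) → (∀ v : ℝ → ENNReal, Literature.MathematicalPhysics.QuantumManyBody.BoseGas.IsRepulsiveFiniteRange v → ∃ ρ₀ : ℝ, 0 < ρ₀ ∧ ∀ ρ : ℝ, 0 < ρ → ρ < ρ₀ → ∀ᶠ N : ℕ in Filter.atTop, Literature.MathematicalPhysics.QuantumManyBody.BoseGas.periodicGroundStateEnergy v N (Literature.MathematicalPhysics.QuantumManyBody.BoseGas.sideLength ρ N) ≠ ⊤ → ∀ η : ℝ, 0 < η → ∃ δ : ENNReal, 0 < δ ∧ ∀ Ψ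 Φ : Literature.MathematicalPhysics.QuantumManyBody.BoseGas.PeriodicTrialState N (Literature.MathematicalPhysics.QuantumManyBody.BoseGas.sideLength ρ N), Literature.MathematicalPhysics.QuantumManyBody.BoseGas.periodicEnergy v Ψ ≤ Literature.MathematicalPhysics.QuantumManyBody.BoseGas.periodicGroundStateEnergy v N (Literature.MathematicalPhysics.QuantumManyBody.BoseGas.sideLength ρ N) + δ → Literature.MathematicalPhysics.QuantumManyBody.BoseGas.periodicEnergy v Φ ≤ Literature.MathematicalPhysics.QuantumManyBody.BoseGas.periodicGroundStateEnergy v N (Literature.MathematicalPhysics.QuantumManyBody.BoseGas.sideLength ρ N) + δ → ∃ θ : ℝ, (∫⁻ X in Literature.MathematicalPhysics.QuantumManyBody.BoseGas.cellN N (Literature.MathematicalPhysics.QuantumManyBody.BoseGas.sideLength ρ N), (‖Ψ.ψ X - Complex.exp (↑θ * Complex.I) * Φ.ψ X‖₊ : ENNReal) ^ 2) ≤ ENNReal.ofReal η) → (∀ v : ℝ → ENNReal, Literature.MathematicalPhysics.QuantumManyBody.BoseGas.IsRepulsiveFiniteRange v → ∃ ρ₀ : ℝ, 0 < ρ₀ ∧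 ∀ ρ : ℝ, 0 < ρ → ρ < ρ₀ → ∀ᶠ N : ℕ in Filter.atTop, Literature.MathematicalPhysics.QuantumManyBody.BoseGas.periodicGroundStateEnergy v N (Literature.MathematicalPhysics.QuantumManyBody.BoseGas.sideLength ρ N) ≠ ⊤) → (∀ v : ℝ → ENNReal, Literature.MathematicalPhysics.QuantumManyBody.BoseGas.IsRepulsiveFiniteRange v → ∃ ρ₀ : ℝ, 0 < ρ₀ ∧ ∀ ρ : ℝ, 0 < ρ → ρ < ρ₀ → ∃ c : ℝ, 0 < c ∧ ∀ᶠ N : ℕ in Filter.atTop, ∃ δ : ENNReal, 0 < δ ∧ ∀ Ψ : Literature.MathematicalPhysics.QuantumManyBody.BoseGas.PeriodicTrialState N (Literature.MathematicalPhysics.QuantumManyBody.BoseGas.sideLength ρ N), Literature.MathematicalPhysics.QuantumManyBody.BoseGas.periodicEnergy v Ψ ≤ Literature.MathematicalPhysics.QuantumManyBody.BoseGas.periodicGroundStateEnergy v N (Literature.MathematicalPhysics.QuantumManyBody.BoseGas.sideLength ρ N) + δ → ENNReal.ofReal (c * N) ≤ Literature.MathematicalPhysics.QuantumManyBody.BoseGas.condensateOccupation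 N (Literature.MathematicalPhysics.QuantumManyBody.BoseGas.sideLength ρ N) Ψ.ψ)

/-- item stmt-AtomisticToContinuum-4209 · support · rank 9 · closed · moot by None · by planner
sources: ReattoChester1967, GhoshLebowitz2017, LiebSeiringerSolovejYngvason2005, doi:10.1007/bf01015731
[support] [support, dictionary row 1: 'S(k) ≍ |k| ⇔ the shadow is a plasma'] for v with scattering
length a > 0: ∃ρ₀ ∀ρ∈(0,ρ₀) ∃C ∀ᶠ n ∀δ>0 ∃ representative Ψ (as in GhostPairScreening) whose
structure factor obeys N·S(k) = ∫_{cellN} |Σ_j e^(ip·x_j)|² Ψ² dX ≤ C·|p|·(n+1) for all p = 2πk/L, k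
∈ ℤ³∖0 (Bogoliubov: S(p) = p/√(p²+16πρa); false for v ≡ 0 where S ≡ 1, hence a > 0). The
Onsager/f-sum side S(k) ≤ k√(χ(k))/2 makes it a bound on the static density response; in the
dictionary it is the perfect-screening (Stillinger–Lovett-type) input that forces the non-integrable
1/r² pair kernel (Ghosh–Lebowitz: hyperuniform ⇒ not tempered Gibbs). [difficulty: open-problem] -/
@[route_item "route-AtomisticToContinuum-BECGhostPlasma"]
def ShadowHyperuniformity : Prop :=
  ∀ v : ℝ → ENNReal, Literature.MathematicalPhysics.QuantumManyBody.BoseGas.IsRepulsiveFiniteRange v → 0 < Literature.MathematicalPhysics.QuantumManyBody.BoseGas.scatteringLength v → ∃ ρ₀ : ℝ, 0 < ρ₀ ∧ ∀ ρ : ℝ, 0 < ρ → ρ < ρ₀ → ∃ C : ℝ, 0 < C ∧ ∀ᶠ n : ℕ in Filter.atTop, ∀ δ : ENNReal, 0 < δ → ∃ Ψ : Literature.MathematicalPhysics.QuantumManyBody.BoseGas.PeriodicTrialState (n + 1) (Literature.MathematicalPhysics.QuantumManyBody.BoseGas.sideLength ρ (n + 1)), Literature.MathematicalPhysics.QuantumManyBody.BoseGas.periodicEnergy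 v Ψ ≤ Literature.MathematicalPhysics.QuantumManyBody.BoseGas.periodicGroundStateEnergy v (n + 1) (Literature.MathematicalPhysics.QuantumManyBody.BoseGas.sideLength ρ (n + 1)) + δ ∧ (∀ X, Ψ.ψ X = (‖Ψ.ψ X‖ : ℂ)) ∧ (∀ (a : EuclideanSpace ℝ (Fin 3)) (X : Fin (n + 1) → EuclideanSpace ℝ (Fin 3)), Ψ.ψ (fun i => X i + a) = Ψ.ψ X) ∧ ∀ k : Fin 3 → ℤ, k ≠ 0 → (∫⁻ X in Literature.MathematicalPhysics.QuantumManyBody.BoseGas.cellN (n + 1) (Literature.MathematicalPhysics.QuantumManyBody.BoseGas.sideLength ρ (n + 1)), (‖∑ j : Fin (n + 1), Complex.exp (Complex.I * ↑(2 * Real.pi / Literature.MathematicalPhysics.QuantumManyBody.BoseGas.sideLength ρ (n + 1) * ∑ i : Fin 3, (k i : ℝ) * X j i))‖₊ : ENNReal) ^ 2 * (‖Ψ.ψ X‖₊ : ENNReal) ^ 2) ≤ ENNReal.ofReal (C * (2 * Real.pi / Literature.MathematicalPhysics.QuantumManyBody.BoseGas.sideLength ρ (n + 1) * ‖(fun i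 => (k i : ℝ))‖)) * ((n : ENNReal) + 1)

/-- item stmt-AtomisticToContinuum-4210 · assembly · rank 1 · closed · moot by None · by planner
sources: LiebSeiringerSolovejYngvason2005
[assembly] GhostPairScreening → PeriodicPhaseRigidity → PeriodicGroundStateEnergyFinite →
BoundaryTransferWeak →
Literature.MathematicalPhysics.QuantumManyBody.BoseGas.BoseEinsteinCondensation (=
Summit.AtomisticToContinuum.BoseEinsteinCondensation). -/
@[route_item "route-AtomisticToContinuum-BECGhostPlasma"]
def Assembly : Prop :=
  (∀ v : ℝ → ENNReal, Literature.MathematicalPhysics.QuantumManyBody.BoseGas.IsRepulsiveFiniteRange v → ∃ ρ₀ : ℝ, 0 < ρ₀ ∧ ∀ ρ : ℝ, 0 < ρ → ρ < ρ₀ → ∃ c : ℝ, 0 < c ∧ ∀ᶠ n : ℕ in Filter.atTop, ∀ δ : ENNReal, 0 < δ → ∃ Ψ : Literature.MathematicalPhysics.QuantumManyBody.BoseGas.PeriodicTrialState (n + 1) (Literature.MathematicalPhysics.QuantumManyBody.BoseGas.sideLength ρ (n + 1)), Literature.MathematicalPhysics.QuantumManyBody.BoseGas.periodicEnergy v Ψ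 ≤ Literature.MathematicalPhysics.QuantumManyBody.BoseGas.periodicGroundStateEnergy v (n + 1) (Literature.MathematicalPhysics.QuantumManyBody.BoseGas.sideLength ρ (n + 1)) + δ ∧ (∀ X, Ψ.ψ X = (‖Ψ.ψ X‖ : ℂ)) ∧ (∀ (a : EuclideanSpace ℝ (Fin 3)) (X : Fin (n + 1) → EuclideanSpace ℝ (Fin 3)), Ψ.ψ (fun i => X i + a) = Ψ.ψ X) ∧ ∀ x y : EuclideanSpace ℝ (Fin 3), ENNReal.ofReal (c * ρ) ≤ (((n : ENNReal) + 1) * ∫⁻ Y in Literature.MathematicalPhysics.QuantumManyBody.BoseGas.cellN n (Literature.MathematicalPhysics.QuantumManyBody.BoseGas.sideLength ρ (n + 1)), (‖Ψ.ψ (Matrix.vecCons x Y)‖₊ : ENNReal) * (‖Ψ.ψ (Matrix.vecCons y Y)‖₊ : ENNReal))) → (∀ v : ℝ → ENNReal, Literature.MathematicalPhysics.QuantumManyBody.BoseGas.IsRepulsiveFiniteRange v → ∃ ρ₀ : ℝ, 0 < ρ₀ ∧ ∀ ρ : ℝ, 0 < ρ → ρ < ρ₀ → ∀ᶠ N : ℕ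 in Filter.atTop, Literature.MathematicalPhysics.QuantumManyBody.BoseGas.periodicGroundStateEnergy v N (Literature.MathematicalPhysics.QuantumManyBody.BoseGas.sideLength ρ N) ≠ ⊤ → ∀ η : ℝ, 0 < η → ∃ δ : ENNReal, 0 < δ ∧ ∀ Ψ Φ : Literature.MathematicalPhysics.QuantumManyBody.BoseGas.PeriodicTrialState N (Literature.MathematicalPhysics.QuantumManyBody.BoseGas.sideLength ρ N), Literature.MathematicalPhysics.QuantumManyBody.BoseGas.periodicEnergy v Ψ ≤ Literature.MathematicalPhysics.QuantumManyBody.BoseGas.periodicGroundStateEnergy v N (Literature.MathematicalPhysics.QuantumManyBody.BoseGas.sideLength ρ N) + δ → Literature.MathematicalPhysics.QuantumManyBody.BoseGas.periodicEnergy v Φ ≤ Literature.MathematicalPhysics.QuantumManyBody.BoseGas.periodicGroundStateEnergy v N (Literature.MathematicalPhysics.QuantumManyBody.BoseGas.sideLength ρ N) + δ → ∃ θ : ℝ, (∫⁻ X in Literature.MathematicalPhysics.QuantumManyBody.BoseGas.cellN N (Literature.MathematicalPhysics.QuantumManyBody.BoseGas.sideLength ρ N), (‖Ψ.ψ X - Complex.exp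 (↑θ * Complex.I) * Φ.ψ X‖₊ : ENNReal) ^ 2) ≤ ENNReal.ofReal η) → (∀ v : ℝ → ENNReal, Literature.MathematicalPhysics.QuantumManyBody.BoseGas.IsRepulsiveFiniteRange v → ∃ ρ₀ : ℝ, 0 < ρ₀ ∧ ∀ ρ : ℝ, 0 < ρ → ρ < ρ₀ → ∀ᶠ N : ℕ in Filter.atTop, Literature.MathematicalPhysics.QuantumManyBody.BoseGas.periodicGroundStateEnergy v N (Literature.MathematicalPhysics.QuantumManyBody.BoseGas.sideLength ρ N) ≠ ⊤) → (∀ v : ℝ → ENNReal, Literature.MathematicalPhysics.QuantumManyBody.BoseGas.IsRepulsiveFiniteRange v → (∃ ρ₀ : ℝ, 0 < ρ₀ ∧ ∀ ρ : ℝ, 0 < ρ → ρ < ρ₀ → ∃ c : ℝ, 0 < c ∧ ∀ᶠ N : ℕ in Filter.atTop, ∃ δ : ENNReal, 0 < δ ∧ ∀ Ψ : Literature.MathematicalPhysics.QuantumManyBody.BoseGas.PeriodicTrialState N (Literature.MathematicalPhysics.QuantumManyBody.BoseGas.sideLength ρ N), Literature.MathematicalPhysics.QuantumManyBody.BoseGas.periodicEnergy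 v Ψ ≤ Literature.MathematicalPhysics.QuantumManyBody.BoseGas.periodicGroundStateEnergy v N (Literature.MathematicalPhysics.QuantumManyBody.BoseGas.sideLength ρ N) + δ → ENNReal.ofReal (c * N) ≤ Literature.MathematicalPhysics.QuantumManyBody.BoseGas.condensateOccupation N (Literature.MathematicalPhysics.QuantumManyBody.BoseGas.sideLength ρ N) Ψ.ψ) → ∃ ρ₀ : ℝ, 0 < ρ₀ ∧ ∀ ρ : ℝ, 0 < ρ → ρ < ρ₀ → Literature.MathematicalPhysics.QuantumManyBody.BoseGas.HasGroundStateBEC v ρ) → Literature.MathematicalPhysics.QuantumManyBody.BoseGas.BoseEinsteinCondensation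

end Summit.AtomisticToContinuum.BoseEinsteinCondensation.Theses.BECGhostPlasma
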